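import Literature.Probability.RandomPlanarGeometry.SAWCountZdSymbolLetterConditions
import HarnessLib

/-!
# THE RUN TYPES `{5,2}`, `{4,3}`, `{4,2,2}` ON `2j` LETTERS: one-block classes cut by one or two isolated no-reversal conditions

Topic `Literature/Probability/RandomPlanarGeometry` (the «SYMBOL POLYNOMIALITY» programme, third layer; on `SAWCountZdSymbolFiveRun.lean` (a-p1 g26: `fiveVec`,
`shapeClass_fiveVec_eq_union`, `disjoint_topVec_topVec_succ`, `card_shapeClass_fiveVec`), `SAWCountZdSymbolSplitRun.lean` (a-p1 g26: `SepAdj`, the reversal-pair count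
`card_revPairs_eq_card_revData` + `card_revData` = `(2j−7)‼2^{2j−3}`, `sep_facts`), λ1–λ3 (`topVec`, `axCls_eq_pair_of_mem`, `not_three_axCls`, the bijection `pairsOf`/`signsOf` ↔
`topData = pairPartitions (outside) ×ˢ powerset (freePos)`, `card_shapeClass_top_eq_card_topData`, `canon_mkWord_pairsOf_signsOf`, `card_outside`, `card_freePos`),
`SAWCountZdSymbolLetterConditions.lean` (a-p1 g27: `card_twoParts_filter_pair_mem`), `SAWCountZdSymbolSecondLowerCount.lean` (`twoParts_eq_pairPartitions`, `card_twoParts_of_card_eq`)).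

PRINTED CONTEXT (locators only; nothing is quoted digit-for-digit). Madras–Slade (1993) §1.1 eq. (1.1.8) p. 5, Definition 1.2.4, §1.2 p. 10; Clisby–Liang–Slade (2007)
§3.3 eqs. (29)/(31); Glimm–Jaffe (1987) (3.2.13). NOT IN PRINT as far as the lane's desks could locate: the statements below.

THE THEOREMS (`m = 2j`, `j ≥ 3`; `a = (2j−5)‼`, `b = (2j−7)‼`, `c = (2j−9)‼`). The three remaining run types of the third-layer top corner `T'_j` (five adjacencies on `2j`
letters; `{6}` is `SAWCountZdSymbolSixRun.lean`): ★★ `card_shapeClass_fivePairVec` — FIVE-RUN + ISOLATED PAIR (`fivePairVec m s q`): the five-run class (two disjoint one-block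
classes) minus the reversal pairs at `(q, q+1)` in each: **`# + 2b·2^{2j−3} = a·2^{2j−1}`**; ★★ `card_shapeClass_fourThreeVec` — BLOCK + RUN OF THREE (`fourThreeVec m i q`): the
one-block class minus the reversal pairs at `(q, q+1)` and at `(q+1, q+2)` (never both: a third occurrence): **`# + 2b·2^{2j−3} = a·2^{2j−2}`**; ★★ `card_shapeClass_fourTwoTwoVec` —
BLOCK + TWO ISOLATED PAIRS (`fourTwoTwoVec m i q q'`): inclusion–exclusion with the DOUBLE reversal count ★ `card_doubleRevPairs` = `c·2^{2j−4}` (two prescribed blocks of the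
matching, `card_twoParts_filter_two_pairs`; two tied sign pairs, `card_powerset_filter_two`): **`# + 2b·2^{2j−3} = a·2^{2j−2} + c·2^{2j−4}`**. Per vector at `j = 4`: `320, 128, 144`;
at `j = 5`: `6912, 3072, 3136`. Tool notions (the lane's): `fivePairVec`, `fourThreeVec`, `fourTwoTwoVec`.

THIS FILE (lane «pcv-sawmu», a-p1 g27; all PROVED, standard axioms): `fivePairVec`, `fivePairVec_eq_true_iff`, `fourThreeVec`, `fourThreeVec_eq_true_iff`, `fourTwoTwoVec`,
`fourTwoTwoVec_eq_true_iff`, `adjValid_fivePairVec`, `breaks_fivePairVec`, `adjValid_fourThreeVec`, `breaks_fourThreeVec`, `adjValid_fourTwoTwoVec`, `breaks_fourTwoTwoVec`,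
★ `shapeClass_fivePairVec_eq_filter`, ★ `shapeClass_block_extra_eq_filter`, ★★ `card_shapeClass_fivePairVec`, ★★ `card_shapeClass_fourThreeVec`, `card_filter_eq_of_injOn` (private),
`rev_iff_pairsOf_signsOf`, ★ `card_twoParts_filter_two_pairs`, `card_powerset_filter_iff'` (private), `card_powerset_filter_two` (private), `card_topData_filter_two`,
★ `card_doubleRevPairs`,
★★ `card_shapeClass_fourTwoTwoVec`.
[cite: MadrasSlade1993, §1.1 eq. (1.1.8) p. 5; Definition 1.2.4; §1.2 (p. 10)] [cite: ClisbyLiangSlade2007, §3.3 eqs. (29)/(31)] [cite: GlimmJaffeQP1987, (3.2.13) §3.2]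

Provenance: lane «pcv-sawmu», a-p1 g27 (2026-08-28).
-/

open Finset
open scoped BigOperators
open Literature.Probability.LatticeModels
open Literature.Probability.RandomPlanarGeometry.SAW
open Literature.Probability.Percolation
open Literature.MathematicalPhysics.QuantumFieldTheory.Balaban1983to89
open Literature.MathematicalPhysics.QuantumFieldTheory.Balaban1983to89.HiggsFluctMeasureWickPairings

namespace Literature.Probability.RandomPlanarGeometry.SAW.Zd

namespace WordTypes

variable {m : ℕ}

/-! ### The three vectors -/

/-- FIVE-RUN + ISOLATED PAIR: adjacencies at `s, s+1, s+2, s+3` and at `q` (run type `{5,2}`). [cite: MadrasSlade1993, Definition 1.2.4; lane tool notion] -/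
def fivePairVec (m s q : ℕ) : Fin m → Bool := fun k => decide ((s ≤ k.val ∧ k.val ≤ s + 3) ∨ k.val = q)

/-- BLOCK + RUN OF THREE: adjacencies at `i, i+1, i+2` and at `q, q+1` (run type `{4,3}`). [cite: MadrasSlade1993, Definition 1.2.4; lane tool notion] -/
def fourThreeVec (m i q : ℕ) : Fin m → Bool := fun k => decide ((i ≤ k.val ∧ k.val ≤ i + 2) ∨ (q ≤ k.val ∧ k.val ≤ q + 1))

/-- BLOCK + TWO ISOLATED PAIRS: adjacencies at `i, i+1, i+2`, `q`, `q'` (run type `{4,2,2}`). [cite: MadrasSlade1993, Definition 1.2.4; lane tool notion] -/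
def fourTwoTwoVec (m i q q' : ℕ) : Fin m → Bool := fun k => decide ((i ≤ k.val ∧ k.val ≤ i + 2) ∨ k.val = q ∨ k.val = q')

/-- Reading `fivePairVec`. [cite: MadrasSlade1993, Definition 1.2.4; lane plumbing] -/
theorem fivePairVec_eq_true_iff {s q : ℕ} (k : Fin m) : fivePairVec m s q k = true ↔ (s ≤ k.val ∧ k.val ≤ s + 3) ∨ k.val = q := by
  simp [fivePairVec]

/-- Reading `fourThreeVec`. [cite: MadrasSlade1993, Definition 1.2.4; lane plumbing] -/
theorem fourThreeVec_eq_true_iff {i q : ℕ} (k : Fin m) : fourThreeVec m i q k = true ↔ (i ≤ k.val ∧ k.val ≤ i + 2) ∨ (q ≤ k.val ∧ k.val ≤ q + 1) := by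
  simp [fourThreeVec]

/-- Reading `fourTwoTwoVec`. [cite: MadrasSlade1993, Definition 1.2.4; lane plumbing] -/
theorem fourTwoTwoVec_eq_true_iff {i q q' : ℕ} (k : Fin m) : fourTwoTwoVec m i q q' k = true ↔ (i ≤ k.val ∧ k.val ≤ i + 2) ∨ k.val = q ∨ k.val = q' := by
  simp [fourTwoTwoVec]

/-- Validity of `fivePairVec` (`s + 5 ≤ m`, `q + 2 ≤ m`). [cite: MadrasSlade1993, Definition 1.2.4; lane plumbing] -/
theorem adjValid_fivePairVec {s q : ℕ} (hs : s + 5 ≤ m) (hq : q + 2 ≤ m) : AdjValid (fivePairVec m s q) := by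
  intro h; rw [Bool.eq_false_iff, Ne, fivePairVec_eq_true_iff]; simp only; omega

/-- Validity of `fourThreeVec` (`i + 4 ≤ m`, `q + 3 ≤ m`). [cite: MadrasSlade1993, Definition 1.2.4; lane plumbing] -/
theorem adjValid_fourThreeVec {i q : ℕ} (hi : i + 4 ≤ m) (hq : q + 3 ≤ m) : AdjValid (fourThreeVec m i q) := by
  intro h; rw [Bool.eq_false_iff, Ne, fourThreeVec_eq_true_iff]; simp only; omega

/-- Validity of `fourTwoTwoVec` (`i + 4 ≤ m`, `q + 2 ≤ m`, `q' + 2 ≤ m`). [cite: MadrasSlade1993, Definition 1.2.4; lane plumbing] -/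
theorem adjValid_fourTwoTwoVec {i q q' : ℕ} (hi : i + 4 ≤ m) (hq : q + 2 ≤ m) (hq' : q' + 2 ≤ m) : AdjValid (fourTwoTwoVec m i q q') := by
  intro h; rw [Bool.eq_false_iff, Ne, fourTwoTwoVec_eq_true_iff]; simp only; omega

open Classical in
/-- A vector whose true set is an explicit five-element finset has `m − 5` breaks. [cite: MadrasSlade1993, Definition 1.2.4; lane plumbing] -/
private theorem breaks_of_true_set {A : Fin m → Bool} (T : Finset (Fin m)) (hT : ∀ k, A k = true ↔ k ∈ T) (h5 : T.card = 5) : breaks A = m - 5 := by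
  unfold breaks
  have htrue : (Finset.univ.filter fun k : Fin m => A k = true) = T := by ext k; rw [Finset.mem_filter, hT]; simp
  have hsum := Finset.card_filter_add_card_filter_not (s := (Finset.univ : Finset (Fin m))) (fun k : Fin m => A k = true)
  simp only [Finset.card_univ, Fintype.card_fin, Bool.not_eq_true] at hsum
  rw [htrue, h5] at hsum
  omega

open Classical in
/-- `breaks (fivePairVec m s q) = m − 5` for separated data. [cite: MadrasSlade1993, Definition 1.2.4; lane plumbing] -/
theorem breaks_fivePairVec {s q : ℕ} (hs : s + 5 ≤ m) (hq : (q + 2 ≤ s ∨ s + 5 ≤ q) ∧ q + 2 ≤ m) : breaks (fivePairVec m s q) = m - 5 := by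
  refine breaks_of_true_set {⟨s, by omega⟩, ⟨s + 1, by omega⟩, ⟨s + 2, by omega⟩, ⟨s + 3, by omega⟩, ⟨q, by omega⟩} (fun k => ?_) ?_
  · rw [fivePairVec_eq_true_iff]; simp only [Finset.mem_insert, Finset.mem_singleton, Fin.ext_iff]; omega
  · rw [Finset.card_insert_of_notMem (by simp [Fin.ext_iff]; omega), Finset.card_insert_of_notMem (by simp [Fin.ext_iff]; omega),
      Finset.card_insert_of_notMem (by simp [Fin.ext_iff]; omega), Finset.card_pair (by simp [Fin.ext_iff]; omega)]

open Classical in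
/-- `breaks (fourThreeVec m i q) = m − 5` for separated data. [cite: MadrasSlade1993, Definition 1.2.4; lane plumbing] -/
theorem breaks_fourThreeVec {i q : ℕ} (hi : i + 4 ≤ m) (hq : (q + 3 ≤ i ∨ i + 4 ≤ q) ∧ q + 3 ≤ m) : breaks (fourThreeVec m i q) = m - 5 := by
  refine breaks_of_true_set {⟨i, by omega⟩, ⟨i + 1, by omega⟩, ⟨i + 2, by omega⟩, ⟨q, by omega⟩, ⟨q + 1, by omega⟩} (fun k => ?_) ?_
  · rw [fourThreeVec_eq_true_iff]; simp only [Finset.mem_insert, Finset.mem_singleton, Fin.ext_iff]; omega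
  · rw [Finset.card_insert_of_notMem (by simp [Fin.ext_iff]; omega), Finset.card_insert_of_notMem (by simp [Fin.ext_iff]; omega),
      Finset.card_insert_of_notMem (by simp [Fin.ext_iff]; omega), Finset.card_pair (by simp [Fin.ext_iff])]

open Classical in
/-- `breaks (fourTwoTwoVec m i q q') = m − 5` for separated data. [cite: MadrasSlade1993, Definition 1.2.4; lane plumbing] -/
theorem breaks_fourTwoTwoVec {i q q' : ℕ} (hi : i + 4 ≤ m) (hq : SepAdj m i q) (hq' : SepAdj m i q') (hqq : q + 2 ≤ q') : breaks (fourTwoTwoVec m i q q') = m - 5 := by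
  unfold SepAdj at hq hq'
  refine breaks_of_true_set {⟨i, by omega⟩, ⟨i + 1, by omega⟩, ⟨i + 2, by omega⟩, ⟨q, by omega⟩, ⟨q', by omega⟩} (fun k => ?_) ?_
  · rw [fourTwoTwoVec_eq_true_iff]; simp only [Finset.mem_insert, Finset.mem_singleton, Fin.ext_iff]; omega
  · rw [Finset.card_insert_of_notMem (by simp [Fin.ext_iff]; omega), Finset.card_insert_of_notMem (by simp [Fin.ext_iff]; omega),
      Finset.card_insert_of_notMem (by simp [Fin.ext_iff]; omega), Finset.card_pair (by simp [Fin.ext_iff]; omega)]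

/-! ### ★ The classes as cut one-block / five-run classes -/

open Classical in
/-- ★ FIVE-RUN + ISOLATED PAIR: the class is the five-run class cut by the no-reversal condition at `(q, q+1)` (every `m`): the isolated adjacency carries no zero block.
[cite: MadrasSlade1993, Definition 1.2.4; lane theorem] -/
theorem shapeClass_fivePairVec_eq_filter {j s q : ℕ} (hq : (q + 2 ≤ s ∨ s + 5 ≤ q) ∧ q + 2 ≤ m) :
    shapeClass j m (fivePairVec m s q) =
      (shapeClass j m (fiveVec m s)).filter fun κ => ¬ κ ⟨q + 1, by omega⟩ = ((κ ⟨q, by omega⟩).1, !(κ ⟨q, by omega⟩).2) := by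
  ext κ
  rw [Finset.mem_filter, mem_shapeClass_iff, mem_shapeClass_iff]
  constructor
  · rintro ⟨hcan, hax, hrep, hnr, a, a', haa', ha', hA, hpos⟩
    have h4 := four_le_of_zero_block _ κ hnr haa' ha' hA hpos
    have h1 := hA ⟨a, by omega⟩ le_rfl (by simp only; omega)
    have h2 := hA ⟨a + 1, by omega⟩ (by simp only; omega) (by simp only; omega)
    rw [fivePairVec_eq_true_iff] at h1 h2
    simp only at h1 h2
    refine ⟨⟨hcan, hax, hrep, fun k hk hAk => hnr k hk ?_, ⟨a, a', haa', ha', fun k hk hk' => ?_, hpos⟩⟩, ?_⟩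
    · rw [fiveVec_eq_true_iff] at hAk; exact (fivePairVec_eq_true_iff k).2 (Or.inl hAk)
    · have := hA k hk hk'
      rw [fivePairVec_eq_true_iff] at this
      rw [fiveVec_eq_true_iff]
      -- all adjacencies of the block are in the five-run: `q` is isolated
      have hk0 := hA ⟨a, by omega⟩ le_rfl (by simp only; omega)
      rw [fivePairVec_eq_true_iff] at hk0; simp only at hk0
      rcases this with h | h
      · exact h
      · exfalso
        -- `k = q`: then `k - 1` or `k + 1` is also an adjacency of the block, contradicting isolation — or the block is `[q, q+2)`: too short
        by_cases hka : k.val = a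
        · -- then `a + 1` is an adjacency (length ≥ 4)
          have h2' := hA ⟨a + 1, by omega⟩ (by simp only; omega) (by simp only; omega)
          rw [fivePairVec_eq_true_iff] at h2'; simp only at h2'; omega
        · have h2' := hA ⟨k.val - 1, by omega⟩ (by simp only; omega) (by simp only; omega)
          rw [fivePairVec_eq_true_iff] at h2'; simp only at h2'; omega
    · exact hnr ⟨q, by omega⟩ (by simp only; omega) ((fivePairVec_eq_true_iff _).2 (Or.inr rfl))
  · rintro ⟨⟨hcan, hax, hrep, hnr, a, a', haa', ha', hA, hpos⟩, hq1⟩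
    refine ⟨hcan, hax, hrep, fun k hk hAk => ?_, ⟨a, a', haa', ha', fun k hk hk' => ?_, hpos⟩⟩
    · rw [fivePairVec_eq_true_iff] at hAk
      rcases hAk with hAk | hAk
      · exact hnr k hk ((fiveVec_eq_true_iff k).2 hAk)
      · have e1 : (⟨k.val + 1, hk⟩ : Fin m) = ⟨q + 1, by omega⟩ := Fin.ext (by simp only; omega)
        have e0 : κ k = κ ⟨q, by omega⟩ := congrArg κ (Fin.ext hAk)
        rw [e1, e0]; exact hq1
    · have := hA k hk hk'
      rw [fiveVec_eq_true_iff] at this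
      exact (fivePairVec_eq_true_iff k).2 (Or.inl this)

open Classical in
/-- ★ BLOCK + EXTRA ISOLATED ADJACENCIES: if `A` agrees with `topVec m i` on `[i, i+3)` and every other adjacency `k` of `A` has `k − 1 ∉ A` when `k ≥ 1` — i.e. the other
runs have length `≤ 3`… — more simply: if every adjacency of `A` outside `{i, i+1, i+2}` lies in a set `E` of positions with `k ∈ E → k + 1 ∉ E ∨ k + 2 ∉ A-range`,
the class is the one-block class cut by the no-reversal conditions on `E`. Here in the concrete form used twice: the extra adjacencies form a set `E` with no three
consecutive members `k, k+1, k+2` all adjacencies together with the block (so no zero block fits there). [cite: MadrasSlade1993, Definition 1.2.4; lane theorem] -/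
theorem shapeClass_block_extra_eq_filter {j i : ℕ} (hi : i + 4 ≤ m) (A : Fin m → Bool)
    (hA : ∀ k : Fin m, A k = true ↔ (i ≤ k.val ∧ k.val ≤ i + 2) ∨ (A k = true ∧ (k.val + 2 ≤ i ∨ i + 4 ≤ k.val)))
    (hshort : ∀ k : Fin m, A k = true → ¬ (i ≤ k.val ∧ k.val ≤ i + 2) → ∀ h2 : k.val + 2 < m, A ⟨k.val + 1, by omega⟩ = true → A ⟨k.val + 2, h2⟩ = true → False) :
    shapeClass j m A = (shapeClass j m (topVec m i)).filter fun κ => ∀ k : Fin m, ∀ hk : k.val + 1 < m, A k = true → ¬ (i ≤ k.val ∧ k.val ≤ i + 2) →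
      ¬ κ ⟨k.val + 1, hk⟩ = ((κ k).1, !(κ k).2) := by
  ext κ
  rw [Finset.mem_filter, mem_shapeClass_iff, mem_shapeClass_iff]
  constructor
  · rintro ⟨hcan, hax, hrep, hnr, a, a', haa', ha', hAr, hpos⟩
    have h4 := four_le_of_zero_block _ κ hnr haa' ha' hAr hpos
    have h0 := hAr ⟨a, by omega⟩ le_rfl (by simp only; omega)
    have h1 := hAr ⟨a + 1, by omega⟩ (by simp only; omega) (by simp only; omega)
    have h2 := hAr ⟨a + 2, by omega⟩ (by simp only; omega) (by simp only; omega)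
    -- the block starts in `[i, i+2]`: otherwise three consecutive extra adjacencies
    have ha : i ≤ a ∧ a ≤ i + 2 := by
      by_contra hna
      exact hshort ⟨a, by omega⟩ h0 (by simp only; exact hna) (by simp only; omega) h1 h2
    -- in fact `a = i` and `a' = a + 4`
    have hai : a = i := by
      rcases (show a = i ∨ a = i + 1 ∨ a = i + 2 by omega) with h | h | h
      · exact h
      · exfalso
        have h2' := (hA ⟨a + 2, by omega⟩).1 h2
        simp only at h2'
        rcases h2' with h2' | ⟨-, h2'⟩ <;> omega
      · exfalso
        have h1' := (hA ⟨a + 1, by omega⟩).1 h1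
        simp only at h1'
        rcases h1' with h1' | ⟨-, h1'⟩ <;> omega
    subst hai
    have ha4 : a' = a + 4 := by
      by_contra hne
      have h3 := hAr ⟨a + 3, by omega⟩ (by simp only; omega) (by simp only; omega)
      have h3' := (hA ⟨a + 3, by omega⟩).1 h3
      simp only at h3'
      rcases h3' with h3' | ⟨-, h3'⟩ <;> omega
    subst ha4
    refine ⟨⟨hcan, hax, hrep, fun k hk hAk => hnr k hk ?_, ⟨a, a + 4, haa', ha', fun k hk hk' => (topVec_eq_true_iff k).2 ⟨hk, by omega⟩, hpos⟩⟩,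
      fun k hk hAk _ => hnr k hk hAk⟩
    rw [topVec_eq_true_iff] at hAk
    exact (hA k).2 (Or.inl hAk)
  · rintro ⟨⟨hcan, hax, hrep, hnr, a, a', haa', ha', hAr, hpos⟩, hE⟩
    refine ⟨hcan, hax, hrep, fun k hk hAk => ?_, ⟨a, a', haa', ha', fun k hk hk' => ?_, hpos⟩⟩
    · by_cases hkb : i ≤ k.val ∧ k.val ≤ i + 2
      · exact hnr k hk ((topVec_eq_true_iff k).2 hkb)
      · exact hE k hk hAk hkb
    · have := hAr k hk hk'
      rw [topVec_eq_true_iff] at this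
      exact (hA k).2 (Or.inl this)

/-! ### ★★ The counts of `{5,2}` and `{4,3}` -/

section Counts

variable {j : ℕ}

open Classical in
/-- ★★ THE `{5,2}` CLASS COUNT (`m = 2j`, `j ≥ 3`): `#shapeClass j (2j) (fivePairVec (2j) s q) + 2·(2j−7)‼·2^{2j−3} = (2j−5)‼·2^{2j−1}` — the two one-block classes of the
five-run each lose their reversal pairs at `(q, q+1)`. [cite: MadrasSlade1993, Definition 1.2.4; lane theorem] -/
theorem card_shapeClass_fivePairVec {s q : ℕ} (hj : 3 ≤ j) (hs : s + 5 ≤ 2 * j) (hq : (q + 2 ≤ s ∨ s + 5 ≤ q) ∧ q + 2 ≤ 2 * j) :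
    (shapeClass j (2 * j) (fivePairVec (2 * j) s q)).card + 2 * ((2 * j - 7).doubleFactorial * 2 ^ (2 * j - 3)) = (2 * j - 5).doubleFactorial * 2 ^ (2 * j - 1) := by
  have hq0 : SepAdj (2 * j) s q := ⟨by omega, hq.2⟩
  have hq1 : SepAdj (2 * j) (s + 1) q := ⟨by omega, hq.2⟩
  rw [shapeClass_fivePairVec_eq_filter hq, shapeClass_fiveVec_eq_union rfl hs, Finset.filter_union,
    Finset.card_union_of_disjoint (Finset.disjoint_filter_filter (disjoint_topVec_topVec_succ rfl hs))]
  have h0 := Finset.card_filter_add_card_filter_not (s := shapeClass j (2 * j) (topVec (2 * j) s))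
    (fun κ => κ ⟨q + 1, by omega⟩ = ((κ ⟨q, by omega⟩).1, !(κ ⟨q, by omega⟩).2))
  have h1 := Finset.card_filter_add_card_filter_not (s := shapeClass j (2 * j) (topVec (2 * j) (s + 1)))
    (fun κ => κ ⟨q + 1, by omega⟩ = ((κ ⟨q, by omega⟩).1, !(κ ⟨q, by omega⟩).2))
  rw [card_revPairs_eq_card_revData rfl (by omega) hq0, card_revData rfl hj (by omega) hq0, card_shapeClass_top (by omega)] at h0
  rw [card_revPairs_eq_card_revData rfl hs hq1, card_revData rfl hj hs hq1, card_shapeClass_top hs] at h1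
  have h2 : (2 * j - 5).doubleFactorial * 2 ^ (2 * j - 1) = 2 * ((2 * j - 5).doubleFactorial * 2 ^ (2 * j - 2)) := by
    rw [show 2 * j - 1 = (2 * j - 2) + 1 by omega, pow_succ]; ring
  rw [h2]; omega

open Classical in
/-- ★★ THE `{4,3}` CLASS COUNT (`m = 2j`, `j ≥ 3`): `#shapeClass j (2j) (fourThreeVec (2j) i q) + 2·(2j−7)‼·2^{2j−3} = (2j−5)‼·2^{2j−2}` — the one-block class minus the
reversal pairs at `(q, q+1)` and at `(q+1, q+2)`; both at once would be a third occurrence. [cite: MadrasSlade1993, Definition 1.2.4; lane theorem] -/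
theorem card_shapeClass_fourThreeVec {i q : ℕ} (hj : 3 ≤ j) (hi : i + 4 ≤ 2 * j) (hq : (q + 3 ≤ i ∨ i + 4 ≤ q) ∧ q + 3 ≤ 2 * j) :
    (shapeClass j (2 * j) (fourThreeVec (2 * j) i q)).card + 2 * ((2 * j - 7).doubleFactorial * 2 ^ (2 * j - 3)) = (2 * j - 5).doubleFactorial * 2 ^ (2 * j - 2) := by
  set T := shapeClass j (2 * j) (topVec (2 * j) i) with hT
  set R1 := T.filter fun κ => κ ⟨q + 1, by omega⟩ = ((κ ⟨q, by omega⟩).1, !(κ ⟨q, by omega⟩).2) with hR1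
  set R2 := T.filter fun κ => κ ⟨q + 1 + 1, by omega⟩ = ((κ ⟨q + 1, by omega⟩).1, !(κ ⟨q + 1, by omega⟩).2) with hR2
  have hq0 : SepAdj (2 * j) i q := ⟨by omega, by omega⟩
  have hq1 : SepAdj (2 * j) i (q + 1) := ⟨by omega, by omega⟩
  have hcls : shapeClass j (2 * j) (fourThreeVec (2 * j) i q) = T \ (R1 ∪ R2) := by
    rw [shapeClass_block_extra_eq_filter hi (fourThreeVec (2 * j) i q) (fun k => by rw [fourThreeVec_eq_true_iff]; omega)
      (fun k hk hnb h2 hk1 hk2 => by rw [fourThreeVec_eq_true_iff] at hk hk1 hk2; simp only at hk hk1 hk2; omega)]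
    ext κ
    rw [Finset.mem_filter, Finset.mem_sdiff, Finset.mem_union, hR1, hR2, Finset.mem_filter, Finset.mem_filter, ← hT]
    constructor
    · rintro ⟨hκ, hE⟩
      refine ⟨hκ, ?_⟩
      rintro (⟨-, h⟩ | ⟨-, h⟩)
      · exact hE ⟨q, by omega⟩ (by simp only; omega) ((fourThreeVec_eq_true_iff _).2 (Or.inr ⟨le_rfl, by simp only; omega⟩)) (by simp only; omega) h
      · exact hE ⟨q + 1, by omega⟩ (by simp only; omega) ((fourThreeVec_eq_true_iff _).2 (Or.inr ⟨by simp only; omega, le_rfl⟩)) (by simp only; omega) h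
    · rintro ⟨hκ, hn⟩
      refine ⟨hκ, fun k hk hAk hnb h => hn ?_⟩
      rw [fourThreeVec_eq_true_iff] at hAk
      have hkq : k.val = q ∨ k.val = q + 1 := by omega
      rcases hkq with hkq | hkq
      · left; refine ⟨hκ, ?_⟩
        have e0 : κ k = κ ⟨q, by omega⟩ := congrArg κ (Fin.ext hkq)
        have e1 : (⟨k.val + 1, hk⟩ : Fin (2 * j)) = ⟨q + 1, by omega⟩ := Fin.ext (by simp only; omega)
        rw [← e0, ← e1]; exact h
      · right; refine ⟨hκ, ?_⟩
        have e0 : κ k = κ ⟨q + 1, by omega⟩ := congrArg κ (Fin.ext hkq)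
        have e1 : (⟨k.val + 1, hk⟩ : Fin (2 * j)) = ⟨q + 1 + 1, by omega⟩ := Fin.ext (by simp only; omega)
        rw [← e0, ← e1]; exact h
  -- the two reversal sets are disjoint (a third occurrence of the axis of `q`)
  have hdis : Disjoint R1 R2 := by
    rw [Finset.disjoint_left]
    intro κ h1 h2
    rw [hR1, Finset.mem_filter] at h1
    rw [hR2, Finset.mem_filter] at h2
    have a1 : (κ ⟨q + 1, by omega⟩).1 = (κ ⟨q, by omega⟩).1 := by rw [h1.2]
    have a2 : (κ ⟨q + 1 + 1, by omega⟩).1 = (κ ⟨q, by omega⟩).1 := by rw [h2.2, a1]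
    exact not_three_axCls rfl h1.1 (a := ⟨q, by omega⟩) (b := ⟨q + 1, by omega⟩) (c := ⟨q + 1 + 1, by omega⟩)
      (by simp only [ne_eq, Fin.ext_iff]; omega) (by simp only [ne_eq, Fin.ext_iff]; omega) (by simp only [ne_eq, Fin.ext_iff]; omega) a1 a2
  have c1 : R1.card = (2 * j - 7).doubleFactorial * 2 ^ (2 * j - 3) := by
    rw [hR1, hT, card_revPairs_eq_card_revData rfl hi hq0, card_revData rfl hj hi hq0]
  have c2 : R2.card = (2 * j - 7).doubleFactorial * 2 ^ (2 * j - 3) := by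
    rw [hR2, hT, card_revPairs_eq_card_revData rfl hi hq1, card_revData rfl hj hi hq1]
  have hsub : R1 ∪ R2 ⊆ T := Finset.union_subset (Finset.filter_subset _ _) (Finset.filter_subset _ _)
  rw [hcls, Finset.card_sdiff_of_subset hsub, Finset.card_union_of_disjoint hdis, c1, c2, hT, card_shapeClass_top hi]
  have : 2 * ((2 * j - 7).doubleFactorial * 2 ^ (2 * j - 3)) ≤ (2 * j - 5).doubleFactorial * 2 ^ (2 * j - 2) := by
    have h := Finset.card_le_card hsub
    rw [Finset.card_union_of_disjoint hdis, c1, c2, hT, card_shapeClass_top hi] at h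
    omega
  omega

end Counts

/-! ### ★ The double reversal count through λ3's bijection -/

section Double

variable {j i : ℕ}

/-- Transport of filtered cardinalities along a bijection (left inverse + equal cardinalities). [cite: MadrasSlade1993, Definition 1.2.4; lane plumbing] -/
private theorem card_filter_eq_of_injOn {α β : Type*} [DecidableEq α] [DecidableEq β] {s : Finset α} {t : Finset β} (i : α → β)
    (hi : ∀ a ∈ s, i a ∈ t) (hinj : Set.InjOn i s) (hcard : s.card = t.card) (P : α → Prop) (Q : β → Prop) [DecidablePred P] [DecidablePred Q]
    (hPQ : ∀ a ∈ s, P a ↔ Q (i a)) : (t.filter Q).card = (s.filter P).card := by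
  have himg : s.image i = t :=
    Finset.eq_of_subset_of_card_le (Finset.image_subset_iff.2 hi) (by rw [Finset.card_image_of_injOn hinj, hcard])
  have hfilt : (s.filter P).image i = t.filter Q := by
    ext b
    rw [Finset.mem_image, Finset.mem_filter]
    constructor
    · rintro ⟨a, ha, rfl⟩
      rw [Finset.mem_filter] at ha
      exact ⟨hi a ha.1, (hPQ a ha.1).1 ha.2⟩
    · rintro ⟨hb, hQ⟩
      have hb' : b ∈ s.image i := by rw [himg]; exact hb
      obtain ⟨a, ha, rfl⟩ := Finset.mem_image.1 hb'
      exact ⟨a, Finset.mem_filter.2 ⟨ha, (hPQ a ha).2 hQ⟩, rfl⟩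
  rw [← hfilt, Finset.card_image_of_injOn (fun a ha b hb h =>
    hinj (Finset.mem_filter.1 (Finset.mem_coe.1 ha)).1 (Finset.mem_filter.1 (Finset.mem_coe.1 hb)).1 h)]

/-- Through λ3's bijection a reversal pair at outer `(q, q+1)` is «`{q, q+1}` is a block of the matching, with opposite signs» (`m = 2j`).
[cite: MadrasSlade1993, Definition 1.2.4; lane lemma] -/
theorem rev_iff_pairsOf_signsOf {q : ℕ} (hm : m = 2 * j) (hq : SepAdj m i q) {κ : Word m m} (hκ : κ ∈ shapeClass j m (topVec m i)) :
    κ ⟨q + 1, by unfold SepAdj at hq; omega⟩ = ((κ ⟨q, by unfold SepAdj at hq; omega⟩).1, !(κ ⟨q, by unfold SepAdj at hq; omega⟩).2) ↔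
      (({(⟨q, by unfold SepAdj at hq; omega⟩ : Fin m), ⟨q + 1, by unfold SepAdj at hq; omega⟩} : Finset (Fin m)) ∈ pairsOf i κ ∧
        ((⟨q, by unfold SepAdj at hq; omega⟩ : Fin m) ∈ signsOf i κ ↔ (⟨q + 1, by unfold SepAdj at hq; omega⟩ : Fin m) ∉ signsOf i κ)) := by
  classical
  obtain ⟨hqB, hq1B, hqF, hq1F⟩ := sep_facts hq
  have hq' := hq; unfold SepAdj at hq'
  set Q : Fin m := ⟨q, by omega⟩ with hQ
  set Q1 : Fin m := ⟨q + 1, by omega⟩ with hQ1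
  have hQQ : Q1 ≠ Q := by simp [hQ, hQ1, Fin.ext_iff]
  have hsg : ∀ x : Fin m, x ∈ freePos m i → (x ∈ signsOf i κ ↔ (κ x).2 = true) := by
    intro x hx; unfold signsOf; rw [Finset.mem_filter]; exact ⟨fun h => h.2, fun h => ⟨hx, h⟩⟩
  constructor
  · intro hrev
    have hax : Q1 ∈ axCls κ Q := mem_axCls.2 (by rw [hrev])
    have hcls : axCls κ Q = {Q, Q1} := axCls_eq_pair_of_mem hm hκ hax hQQ
    refine ⟨?_, ?_⟩
    · change ({Q, Q1} : Finset (Fin m)) ∈ (outside m i).image (axCls κ)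
      rw [← hcls]
      exact Finset.mem_image_of_mem _ (mem_outside.2 hqB)
    · rw [hsg Q hqF, hsg Q1 hq1F, hrev]
      simp only
      cases (κ Q).2 <;> simp
  · rintro ⟨hpair, hsign⟩
    change ({Q, Q1} : Finset (Fin m)) ∈ (outside m i).image (axCls κ) at hpair
    obtain ⟨o, -, ho⟩ := Finset.mem_image.1 hpair
    have hQo : Q ∈ axCls κ o := by rw [ho]; simp
    have hQ1o : Q1 ∈ axCls κ o := by rw [ho]; simp
    rw [mem_axCls] at hQo hQ1o
    rw [hsg Q hqF, hsg Q1 hq1F] at hsign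
    refine Prod.ext (by rw [hQ1o, hQo]) ?_
    simp only
    cases h0 : (κ Q).2 <;> cases h1 : (κ Q1).2 <;> simp_all

/-- ★ TWO PRESCRIBED BLOCKS of a partition into blocks of size `≥ 2`: `#{ρ ∈ twoParts W (k+2) | {a,b} ∈ ρ, {c,d} ∈ ρ} = #twoParts ((W ∖ {a,b}) ∖ {c,d}) k` for
disjoint pairs. [cite: MadrasSlade1993, Definition 1.2.4; lane lemma] -/
theorem card_twoParts_filter_two_pairs {W : Finset (Fin m)} {k : ℕ} {a b c d : Fin m} (ha : a ∈ W) (hb : b ∈ W) (hc : c ∈ W) (hd : d ∈ W) (hab : a ≠ b)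
    (hcd : c ≠ d) (hac : a ≠ c) (had : a ≠ d) (hbc : b ≠ c) (hbd : b ≠ d) :
    ((twoParts W (k + 2)).filter fun ρ => ({a, b} : Finset (Fin m)) ∈ ρ ∧ ({c, d} : Finset (Fin m)) ∈ ρ).card = (twoParts ((W \ {a, b}) \ {c, d}) k).card := by
  classical
  have hne : ({c, d} : Finset (Fin m)) ≠ {a, b} := by
    intro h
    have : c ∈ ({a, b} : Finset (Fin m)) := by rw [← h]; simp
    simp only [Finset.mem_insert, Finset.mem_singleton] at this
    rcases this with h1 | h1
    · exact hac h1.symm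
    · exact hbc h1.symm
  have hc' : c ∈ W \ {a, b} := Finset.mem_sdiff.2 ⟨hc, by simp [Ne.symm hac, Ne.symm hbc]⟩
  have hd' : d ∈ W \ {a, b} := Finset.mem_sdiff.2 ⟨hd, by simp [Ne.symm had, Ne.symm hbd]⟩
  rw [← card_twoParts_filter_pair_mem hc' hd' hcd]
  -- the single-pair bijection `ρ ↦ ρ.erase {a,b}` restricted to `{c,d} ∈ ρ`
  have step : (((twoParts W (k + 2)).filter fun ρ => ({a, b} : Finset (Fin m)) ∈ ρ).filter fun ρ => ({c, d} : Finset (Fin m)) ∈ ρ).card =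
      ((twoParts (W \ {a, b}) (k + 1)).filter fun σ => ({c, d} : Finset (Fin m)) ∈ σ).card := by
    symm
    refine card_filter_eq_of_injOn (fun ρ => ρ.erase {a, b}) (fun ρ hρ => ?_) (fun ρ hρ ρ' hρ' h => ?_)
      (card_twoParts_filter_pair_mem ha hb hab) _ _ (fun ρ _ => ?_)
    · rw [Finset.mem_filter, mem_twoParts] at hρ
      obtain ⟨⟨hρ, h2, hk⟩, hab'⟩ := hρ
      rw [mem_twoParts]
      exact ⟨hρ.erase hab', fun B hB => h2 B (Finset.mem_of_mem_erase hB), by rw [Finset.card_erase_of_mem hab', hk, Nat.add_sub_cancel]⟩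
    · rw [Finset.mem_coe, Finset.mem_filter] at hρ hρ'
      have e := congrArg (insert ({a, b} : Finset (Fin m))) h
      simp only [Finset.insert_erase hρ.2, Finset.insert_erase hρ'.2] at e
      exact e
    · rw [Finset.mem_erase]
      exact ⟨fun h => ⟨hne, h⟩, fun h => h.2⟩
  rw [← step, Finset.filter_filter]

/-- Sign sets with one tied pair of memberships: `2^{#F−1}`. [cite: MadrasSlade1993, Definition 1.2.4; lane plumbing] -/
private theorem card_powerset_filter_iff' {F : Finset (Fin m)} {a b : Fin m} (hab : a ≠ b) (ha : a ∈ F) :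
    (F.powerset.filter fun S => a ∈ S ↔ b ∉ S).card = 2 ^ (F.card - 1) := by
  classical
  rw [← Finset.card_erase_of_mem ha, ← Finset.card_powerset]
  refine Finset.card_nbij' (fun S => S.erase a) (fun T => if b ∈ T then T else insert a T) (fun S hS => ?_) (fun T hT => ?_) (fun S hS => ?_)
    (fun T hT => ?_)
  · rw [Finset.mem_coe, Finset.mem_filter, Finset.mem_powerset] at hS
    rw [Finset.mem_coe, Finset.mem_powerset]
    exact Finset.erase_subset_erase _ hS.1
  · rw [Finset.mem_coe, Finset.mem_powerset, Finset.subset_erase] at hT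
    rw [Finset.mem_coe, Finset.mem_filter, Finset.mem_powerset]
    dsimp only
    split_ifs with h
    · exact ⟨hT.1, iff_of_false hT.2 (not_not_intro h)⟩
    · refine ⟨Finset.insert_subset ha hT.1, iff_of_true (Finset.mem_insert_self _ _) ?_⟩
      rw [Finset.mem_insert]; push Not; exact ⟨hab.symm, h⟩
  · rw [Finset.mem_coe, Finset.mem_filter, Finset.mem_powerset] at hS
    simp only [Finset.mem_erase, ne_eq, hab.symm, not_false_eq_true, true_and]
    split_ifs with h
    · have : a ∉ S := fun ha' => (hS.2.1 ha') h
      rw [Finset.erase_eq_of_notMem this]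
    · exact Finset.insert_erase (hS.2.2 h)
  · rw [Finset.mem_coe, Finset.mem_powerset, Finset.subset_erase] at hT
    dsimp only
    split_ifs with h
    · exact Finset.erase_eq_of_notMem hT.2
    · exact Finset.erase_insert hT.2

/-- Sign sets with two disjoint tied pairs of memberships: `2^{#F−2}`. [cite: MadrasSlade1993, Definition 1.2.4; lane plumbing] -/
private theorem card_powerset_filter_two {F : Finset (Fin m)} {a b c d : Fin m} (hab : a ≠ b) (hcd : c ≠ d) (hac : a ≠ c) (had : a ≠ d) (ha : a ∈ F) (hc : c ∈ F) :
    (F.powerset.filter fun S => (a ∈ S ↔ b ∉ S) ∧ (c ∈ S ↔ d ∉ S)).card = 2 ^ (F.card - 2) := by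
  classical
  have hc' : c ∈ F.erase a := Finset.mem_erase.2 ⟨Ne.symm hac, hc⟩
  have h1 := card_powerset_filter_iff' hcd hc'
  rw [Finset.card_erase_of_mem ha, show F.card - 1 - 1 = F.card - 2 by omega] at h1
  rw [← h1]
  refine Finset.card_nbij' (fun S => S.erase a) (fun T => if b ∈ T then T else insert a T) (fun S hS => ?_) (fun T hT => ?_) (fun S hS => ?_)
    (fun T hT => ?_)
  · rw [Finset.mem_coe, Finset.mem_filter, Finset.mem_powerset] at hS
    rw [Finset.mem_coe, Finset.mem_filter, Finset.mem_powerset]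
    refine ⟨Finset.erase_subset_erase _ hS.1, ?_⟩
    rw [Finset.mem_erase, Finset.mem_erase]
    simp only [ne_eq, Ne.symm hac, not_false_eq_true, true_and, Ne.symm had]
    exact hS.2.2
  · rw [Finset.mem_coe, Finset.mem_filter, Finset.mem_powerset, Finset.subset_erase] at hT
    rw [Finset.mem_coe, Finset.mem_filter, Finset.mem_powerset]
    dsimp only
    split_ifs with h
    · exact ⟨hT.1.1, iff_of_false hT.1.2 (not_not_intro h), hT.2⟩
    · refine ⟨Finset.insert_subset ha hT.1.1, iff_of_true (Finset.mem_insert_self _ _) ?_, ?_⟩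
      · rw [Finset.mem_insert]; push Not; exact ⟨hab.symm, h⟩
      · rw [Finset.mem_insert, Finset.mem_insert]
        simp only [Ne.symm hac, Ne.symm had, false_or]
        exact hT.2
  · rw [Finset.mem_coe, Finset.mem_filter, Finset.mem_powerset] at hS
    simp only [Finset.mem_erase, ne_eq, hab.symm, not_false_eq_true, true_and]
    split_ifs with h
    · have : a ∉ S := fun ha' => (hS.2.1.1 ha') h
      rw [Finset.erase_eq_of_notMem this]
    · exact Finset.insert_erase (hS.2.1.2 h)
  · rw [Finset.mem_coe, Finset.mem_filter, Finset.mem_powerset, Finset.subset_erase] at hT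
    dsimp only
    split_ifs with h
    · exact Finset.erase_eq_of_notMem hT.1.2
    · exact Finset.erase_insert hT.1.2

open Classical in
/-- The data side of the double reversal count: two prescribed blocks of the matching and two tied sign pairs (`m = 2j`, `j ≥ 4`).
[cite: MadrasSlade1993, Definition 1.2.4; lane lemma] -/
theorem card_topData_filter_two {q q' : ℕ} (hj : 4 ≤ j) (hi : i + 4 ≤ 2 * j) (hq : SepAdj (2 * j) i q) (hq' : SepAdj (2 * j) i q') (hqq : q + 2 ≤ q') :
    ((topData (2 * j) i).filter fun d =>
        (({(⟨q, by unfold SepAdj at hq; omega⟩ : Fin (2 * j)), ⟨q + 1, by unfold SepAdj at hq; omega⟩} : Finset (Fin (2 * j))) ∈ d.1 ∧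
          ({(⟨q', by unfold SepAdj at hq'; omega⟩ : Fin (2 * j)), ⟨q' + 1, by unfold SepAdj at hq'; omega⟩} : Finset (Fin (2 * j))) ∈ d.1) ∧
        (((⟨q, by unfold SepAdj at hq; omega⟩ : Fin (2 * j)) ∈ d.2 ↔ (⟨q + 1, by unfold SepAdj at hq; omega⟩ : Fin (2 * j)) ∉ d.2) ∧
          ((⟨q', by unfold SepAdj at hq'; omega⟩ : Fin (2 * j)) ∈ d.2 ↔ (⟨q' + 1, by unfold SepAdj at hq'; omega⟩ : Fin (2 * j)) ∉ d.2))).card =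
      (2 * j - 9).doubleFactorial * 2 ^ (2 * j - 4) := by
  obtain ⟨hqB, hq1B, hqF, hq1F⟩ := sep_facts hq
  obtain ⟨hq'B, hq1'B, hq'F, hq1'F⟩ := sep_facts hq'
  have hq0 := hq; have hq0' := hq'; unfold SepAdj at hq0 hq0'
  have hO : (outside (2 * j) i).card = 2 * ((j - 4) + 2) := by rw [card_outside hi]; omega
  have hne : ∀ (x y : ℕ) (hx : x < 2 * j) (hy : y < 2 * j), x ≠ y → (⟨x, hx⟩ : Fin (2 * j)) ≠ ⟨y, hy⟩ :=
    fun x y hx hy h h' => h (by simpa using congrArg Fin.val h')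
  have hpart : ((pairPartitions (outside (2 * j) i)).filter fun π => ({(⟨q, by omega⟩ : Fin (2 * j)), ⟨q + 1, by omega⟩} : Finset (Fin (2 * j))) ∈ π ∧
      ({(⟨q', by omega⟩ : Fin (2 * j)), ⟨q' + 1, by omega⟩} : Finset (Fin (2 * j))) ∈ π).card = (2 * j - 9).doubleFactorial := by
    rw [← twoParts_eq_pairPartitions hO, card_twoParts_filter_two_pairs (mem_outside.2 hqB) (mem_outside.2 hq1B) (mem_outside.2 hq'B) (mem_outside.2 hq1'B)
      (hne _ _ _ _ (by omega)) (hne _ _ _ _ (by omega)) (hne _ _ _ _ (by omega)) (hne _ _ _ _ (by omega)) (hne _ _ _ _ (by omega)) (hne _ _ _ _ (by omega))]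
    have hsub1 : ({(⟨q, by omega⟩ : Fin (2 * j)), ⟨q + 1, by omega⟩} : Finset (Fin (2 * j))) ⊆ outside (2 * j) i := by
      intro x hx; simp only [Finset.mem_insert, Finset.mem_singleton] at hx
      rcases hx with rfl | rfl
      · exact mem_outside.2 hqB
      · exact mem_outside.2 hq1B
    have hsub2 : ({(⟨q', by omega⟩ : Fin (2 * j)), ⟨q' + 1, by omega⟩} : Finset (Fin (2 * j))) ⊆ outside (2 * j) i \ {(⟨q, by omega⟩ : Fin (2 * j)), ⟨q + 1, by omega⟩} := by
      intro x hx; simp only [Finset.mem_insert, Finset.mem_singleton] at hx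
      rw [Finset.mem_sdiff]
      rcases hx with rfl | rfl
      · exact ⟨mem_outside.2 hq'B, by simp only [Finset.mem_insert, Finset.mem_singleton, Fin.ext_iff]; omega⟩
      · exact ⟨mem_outside.2 hq1'B, by simp only [Finset.mem_insert, Finset.mem_singleton, Fin.ext_iff]; omega⟩
    have hc : ((outside (2 * j) i \ {(⟨q, by omega⟩ : Fin (2 * j)), ⟨q + 1, by omega⟩}) \ {(⟨q', by omega⟩ : Fin (2 * j)), ⟨q' + 1, by omega⟩}).card = 2 * (j - 4) := by
      rw [Finset.card_sdiff_of_subset hsub2, Finset.card_sdiff_of_subset hsub1, hO, Finset.card_pair (hne _ _ _ _ (by omega)),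
        Finset.card_pair (hne _ _ _ _ (by omega))]
      omega
    rw [card_twoParts_of_card_eq hc]
    congr 1; omega
  have hsign : ((freePos (2 * j) i).powerset.filter fun S => ((⟨q, by omega⟩ : Fin (2 * j)) ∈ S ↔ (⟨q + 1, by omega⟩ : Fin (2 * j)) ∉ S) ∧
      ((⟨q', by omega⟩ : Fin (2 * j)) ∈ S ↔ (⟨q' + 1, by omega⟩ : Fin (2 * j)) ∉ S)).card = 2 ^ (2 * j - 4) := by
    rw [card_powerset_filter_two (hne _ _ _ _ (by omega)) (hne _ _ _ _ (by omega)) (hne _ _ _ _ (by omega)) (hne _ _ _ _ (by omega)) hqF hq'F,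
      card_freePos hi, show 2 * j - 2 - 2 = 2 * j - 4 by omega]
  calc _ = (((pairPartitions (outside (2 * j) i)).filter fun π => ({(⟨q, by omega⟩ : Fin (2 * j)), ⟨q + 1, by omega⟩} : Finset (Fin (2 * j))) ∈ π ∧
          ({(⟨q', by omega⟩ : Fin (2 * j)), ⟨q' + 1, by omega⟩} : Finset (Fin (2 * j))) ∈ π) ×ˢ
        ((freePos (2 * j) i).powerset.filter fun S => ((⟨q, by omega⟩ : Fin (2 * j)) ∈ S ↔ (⟨q + 1, by omega⟩ : Fin (2 * j)) ∉ S) ∧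
          ((⟨q', by omega⟩ : Fin (2 * j)) ∈ S ↔ (⟨q' + 1, by omega⟩ : Fin (2 * j)) ∉ S))).card := by
        congr 1
        ext d
        unfold topData
        simp only [Finset.mem_filter, Finset.mem_product]
        constructor
        · rintro ⟨⟨h1, h2⟩, h3, h4⟩; exact ⟨⟨h1, h3⟩, h2, h4⟩
        · rintro ⟨⟨h1, h3⟩, h2, h4⟩; exact ⟨⟨h1, h2⟩, h3, h4⟩
    _ = (2 * j - 9).doubleFactorial * 2 ^ (2 * j - 4) := by rw [Finset.card_product, hpart, hsign]

open Classical in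
/-- ★ THE DOUBLE REVERSAL COUNT (`m = 2j`, `j ≥ 4`): the one-block class members with reversal pairs at BOTH `(q, q+1)` and `(q', q'+1)` (outer, `q + 2 ≤ q'`) number
`(2j−9)‼·2^{2j−4}` — two prescribed blocks of the matching of the `2j − 4` outside positions and two tied sign pairs. [cite: MadrasSlade1993, Definition 1.2.4; lane theorem] -/
theorem card_doubleRevPairs {q q' : ℕ} (hj : 4 ≤ j) (hi : i + 4 ≤ 2 * j) (hq : SepAdj (2 * j) i q) (hq' : SepAdj (2 * j) i q') (hqq : q + 2 ≤ q') :
    ((shapeClass j (2 * j) (topVec (2 * j) i)).filter fun κ =>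
        κ ⟨q + 1, by unfold SepAdj at hq; omega⟩ = ((κ ⟨q, by unfold SepAdj at hq; omega⟩).1, !(κ ⟨q, by unfold SepAdj at hq; omega⟩).2) ∧
        κ ⟨q' + 1, by unfold SepAdj at hq'; omega⟩ = ((κ ⟨q', by unfold SepAdj at hq'; omega⟩).1, !(κ ⟨q', by unfold SepAdj at hq'; omega⟩).2)).card =
      (2 * j - 9).doubleFactorial * 2 ^ (2 * j - 4) := by
  rw [← card_topData_filter_two hj hi hq hq' hqq]
  symm
  refine card_filter_eq_of_injOn (fun κ => (pairsOf i κ, signsOf i κ)) (fun κ hκ => pairsOf_signsOf_mem_topData rfl hκ hi)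
    (fun κ hκ κ' hκ' h => by
      have e := congrArg (fun d : Finset (Finset (Fin (2 * j))) × Finset (Fin (2 * j)) => canon (mkWord hi d.1 d.2)) h
      simp only [canon_mkWord_pairsOf_signsOf rfl (Finset.mem_coe.1 hκ) hi, canon_mkWord_pairsOf_signsOf rfl (Finset.mem_coe.1 hκ') hi] at e
      exact e)
    (card_shapeClass_top_eq_card_topData rfl hi) _ _ (fun κ hκ => ?_)
  rw [rev_iff_pairsOf_signsOf rfl hq hκ, rev_iff_pairsOf_signsOf rfl hq' hκ]
  exact and_and_and_comm

open Classical in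
/-- ★★ THE `{4,2,2}` CLASS COUNT (`m = 2j`, `j ≥ 4`): `#shapeClass j (2j) (fourTwoTwoVec (2j) i q q') + 2·(2j−7)‼·2^{2j−3} = (2j−5)‼·2^{2j−2} + (2j−9)‼·2^{2j−4}` —
inclusion–exclusion of the two reversal sets inside the one-block class. [cite: MadrasSlade1993, Definition 1.2.4; lane theorem] -/
theorem card_shapeClass_fourTwoTwoVec {q q' : ℕ} (hj : 4 ≤ j) (hi : i + 4 ≤ 2 * j) (hq : SepAdj (2 * j) i q) (hq' : SepAdj (2 * j) i q') (hqq : q + 2 ≤ q') :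
    (shapeClass j (2 * j) (fourTwoTwoVec (2 * j) i q q')).card + 2 * ((2 * j - 7).doubleFactorial * 2 ^ (2 * j - 3)) =
      (2 * j - 5).doubleFactorial * 2 ^ (2 * j - 2) + (2 * j - 9).doubleFactorial * 2 ^ (2 * j - 4) := by
  have hq0 := hq; have hq0' := hq'; unfold SepAdj at hq0 hq0'
  set T := shapeClass j (2 * j) (topVec (2 * j) i) with hT
  set R1 := T.filter fun κ => κ ⟨q + 1, by omega⟩ = ((κ ⟨q, by omega⟩).1, !(κ ⟨q, by omega⟩).2) with hR1
  set R2 := T.filter fun κ => κ ⟨q' + 1, by omega⟩ = ((κ ⟨q', by omega⟩).1, !(κ ⟨q', by omega⟩).2) with hR2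
  have hcls : shapeClass j (2 * j) (fourTwoTwoVec (2 * j) i q q') = T \ (R1 ∪ R2) := by
    rw [shapeClass_block_extra_eq_filter hi (fourTwoTwoVec (2 * j) i q q') (fun k => by rw [fourTwoTwoVec_eq_true_iff]; omega)
      (fun k hk hnb h2 hk1 hk2 => by rw [fourTwoTwoVec_eq_true_iff] at hk hk1 hk2; simp only at hk hk1 hk2; omega)]
    ext κ
    rw [Finset.mem_filter, Finset.mem_sdiff, Finset.mem_union, hR1, hR2, Finset.mem_filter, Finset.mem_filter, ← hT]
    constructor
    · rintro ⟨hκ, hE⟩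
      refine ⟨hκ, ?_⟩
      rintro (⟨-, h⟩ | ⟨-, h⟩)
      · exact hE ⟨q, by omega⟩ (by simp only; omega) ((fourTwoTwoVec_eq_true_iff _).2 (Or.inr (Or.inl rfl))) (by simp only; omega) h
      · exact hE ⟨q', by omega⟩ (by simp only; omega) ((fourTwoTwoVec_eq_true_iff _).2 (Or.inr (Or.inr rfl))) (by simp only; omega) h
    · rintro ⟨hκ, hn⟩
      refine ⟨hκ, fun k hk hAk hnb h => hn ?_⟩
      rw [fourTwoTwoVec_eq_true_iff] at hAk
      have hkq : k.val = q ∨ k.val = q' := by omega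
      rcases hkq with hkq | hkq
      · left; refine ⟨hκ, ?_⟩
        have e0 : κ k = κ ⟨q, by omega⟩ := congrArg κ (Fin.ext hkq)
        have e1 : (⟨k.val + 1, hk⟩ : Fin (2 * j)) = ⟨q + 1, by omega⟩ := Fin.ext (by simp only; omega)
        rw [← e0, ← e1]; exact h
      · right; refine ⟨hκ, ?_⟩
        have e0 : κ k = κ ⟨q', by omega⟩ := congrArg κ (Fin.ext hkq)
        have e1 : (⟨k.val + 1, hk⟩ : Fin (2 * j)) = ⟨q' + 1, by omega⟩ := Fin.ext (by simp only; omega)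
        rw [← e0, ← e1]; exact h
  have c1 : R1.card = (2 * j - 7).doubleFactorial * 2 ^ (2 * j - 3) := by
    rw [hR1, hT, card_revPairs_eq_card_revData rfl hi hq, card_revData rfl (by omega) hi hq]
  have c2 : R2.card = (2 * j - 7).doubleFactorial * 2 ^ (2 * j - 3) := by
    rw [hR2, hT, card_revPairs_eq_card_revData rfl hi hq', card_revData rfl (by omega) hi hq']
  have c12 : (R1 ∩ R2).card = (2 * j - 9).doubleFactorial * 2 ^ (2 * j - 4) := by
    rw [hR1, hR2, ← Finset.filter_and, hT]
    exact card_doubleRevPairs hj hi hq hq' hqq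
  have hsub : R1 ∪ R2 ⊆ T := Finset.union_subset (Finset.filter_subset _ _) (Finset.filter_subset _ _)
  have hie := Finset.card_union_add_card_inter R1 R2
  have hle := Finset.card_le_card hsub
  rw [hcls, Finset.card_sdiff_of_subset hsub, hT, card_shapeClass_top hi]
  rw [hT, card_shapeClass_top hi] at hle
  omega

end Double

end WordTypes

end Literature.Probability.RandomPlanarGeometry.SAW.Zd
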